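import Summits.AtomisticToContinuum.Crystallization.Theorems.FreeSplittingCertificatesRadiusLadderHardCoreLadder
import Summits.AtomisticToContinuum.Crystallization.Theorems.FreeSplittingCertificatesRadiusLadderClosedRegion

/-!
# Free splitting certificates — hard-core removal on the radius ladder, III: no hard core at all
(route `FreeSplittingCertificates`, crux r2 `FiniteRangeSplitting`, stmt-AtomisticToContinuum-12559)

VALUE = a structural theorem about the crux (the quantifiers `∀ δ > 0 ∃ R ∃ Φ` of crux r2 collapse to
`∃ R ∃ Φ`, valid on EVERY finite configuration of distinct points) — NOT summit progress.

Part II (`rungAt_of_rungAt_two_fifths`) gives, from one rung at hard core `2/5` and radius `R`, a rung at EVERY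
hard core `δ > 0` read at the SAME radius `R + 1`.  Compactness of the rule space (part `…Compactness`:
Tychonoff box, closed rule axioms, closed feasibility) then produces ONE rule feasible at every hard core at
once (`exists_rule_forall_sep`: the sets of rules feasible at hard core `1/(n+1)` are nested nonempty compacts),
and a finite configuration of distinct points is `δ`-separated for its own minimal distance
(`exists_sep_of_injective`).  Hence

* `finiteRangeSplitting_iff_uniform` : crux r2 `↔ ∃ R > 0, ∃ Φ, IsRule Φ ∧` for every `N`, every INJECTIVE
  `x : Fin N → ℝ³` and every site `i`, `e_∞ ≤ siteE R Φ x i` — one radius, one rule, no hard core;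
* `finiteRangeSplitting_iff_exists_sepThreshold_eq_zero` : crux r2 `↔ ∃ R > 0, δ*(R) = 0`;
* `sepThreshold_dichotomy` : either `δ*(R) ≥ 2/5` for every radius (`↔ ¬` crux r2), or `δ*(R) = 0` for all
  large `R`;
* `radThreshold_bounded_of_finiteRangeSplitting` : under crux r2 the minimal rung radius `R*(δ)` is bounded
  uniformly in the hard core (no radius blow-up as `δ → 0`).
-/

noncomputable section

open scoped BigOperators Classical
open Filter Topology
open Literature.MathematicalPhysics.StatisticalMechanics

namespace Summit.AtomisticToContinuum.Crystallization.Theorems.StrictSplittingRuleBirth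

/-- Euclidean `3`-space. -/
local notation "E3" => EuclideanSpace ℝ (Fin 3)

/-! ## §8  One rule for every hard core (compactness) -/

/-- Zero tolerance is exact feasibility. -/
theorem afeasible_zero_iff (δ R : ℝ) (Φ : E3 → Finset E3 → ℝ) : AFeasible δ 0 R Φ ↔ Feasible δ R Φ := by
  simp only [AFeasible, Feasible, sub_zero]

/-- **A universal rule.**  If every hard core `1/(n+1)` carries a rung at the fixed radius `R`, then ONE rule is
feasible at radius `R` for every hard core `δ > 0` simultaneously: the sets of rules feasible at hard core
`1/(n+1)` are nested (feasibility is monotone in the hard core), nonempty, closed subsets of the compact rule box.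
[folklore] -/
theorem exists_rule_forall_sep {R : ℝ} (h : ∀ n : ℕ, RungAt (1 / ((n : ℝ) + 1)) R) :
    ∃ Φ : E3 → Finset E3 → ℝ, IsRule Φ ∧ ∀ δ : ℝ, 0 < δ → Feasible δ R Φ := by
  let t : ℕ → Set (E3 → Finset E3 → ℝ) := fun n =>
    {Φ | IsRule Φ} ∩ {Φ | AFeasible (1 / ((n : ℝ) + 1)) 0 R Φ}
  have htd : ∀ n, t (n + 1) ⊆ t n := by
    intro n Φ hΦ
    have h1 : Feasible (1 / (((n + 1 : ℕ) : ℝ) + 1)) R Φ := (afeasible_zero_iff _ _ _).1 hΦ.2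
    refine ⟨hΦ.1, (afeasible_zero_iff _ _ _).2 (feasible_mono_sep ?_ h1)⟩
    push_cast
    exact one_div_le_one_div_of_le (by positivity) (by linarith)
  have htn : ∀ n, (t n).Nonempty := fun n => by
    obtain ⟨Φ, hr, hf⟩ := h n
    exact ⟨Φ, hr, (afeasible_zero_iff _ _ _).2 hf⟩
  have htcl : ∀ n, IsClosed (t n) := fun n =>
    isClosed_setOf_isRule.inter (isClosed_setOf_afeasible _ _ _)
  have ht0 : IsCompact (t 0) := isCompact_setOf_arung _ _ _
  obtain ⟨Φ, hΦ⟩ := IsCompact.nonempty_iInter_of_sequence_nonempty_isCompact_isClosed t htd htn ht0 htcl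
  have hmem : ∀ n, Φ ∈ t n := Set.mem_iInter.1 hΦ
  refine ⟨Φ, (hmem 0).1, fun δ hδ => ?_⟩
  obtain ⟨n, hn⟩ := exists_nat_one_div_lt hδ
  exact feasible_mono_sep hn.le ((afeasible_zero_iff _ _ _).1 (hmem n).2)

/-- From one rung at hard core `2/5` (radius `R ≥ 0`): ONE rule feasible at radius `R + 1` for every hard core. -/
theorem exists_rule_forall_sep_of_rungAt_two_fifths {R : ℝ} (hR : 0 ≤ R) (h : RungAt (2 / 5) R) :
    ∃ Φ : E3 → Finset E3 → ℝ, IsRule Φ ∧ ∀ δ : ℝ, 0 < δ → Feasible δ (R + 1) Φ :=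
  exists_rule_forall_sep fun n => rungAt_of_rungAt_two_fifths hR h (by positivity)

/-! ## §9  Configurations of distinct points -/

/-- A finite configuration of distinct points is `δ`-separated for some `δ > 0` (its minimal distance, or `1` if it
has fewer than two points). [folklore] -/
theorem exists_sep_of_injective {N : ℕ} {x : Fin N → E3} (hx : Function.Injective x) :
    ∃ δ : ℝ, 0 < δ ∧ Sep δ x := by
  let S : Finset (Fin N × Fin N) := Finset.univ.filter fun p => p.1 ≠ p.2
  by_cases hS : S.Nonempty
  · obtain ⟨p, hp, hmin⟩ := S.exists_min_image (fun q => dist (x q.1) (x q.2)) hS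
    have hp' : p.1 ≠ p.2 := (Finset.mem_filter.1 hp).2
    refine ⟨dist (x p.1) (x p.2), dist_pos.2 fun heq => hp' (hx heq), fun i j hij => ?_⟩
    exact hmin (i, j) (Finset.mem_filter.2 ⟨Finset.mem_univ _, hij⟩)
  · refine ⟨1, one_pos, fun i j hij => ?_⟩
    exact absurd ⟨(i, j), Finset.mem_filter.2 ⟨Finset.mem_univ _, hij⟩⟩ hS

/-- Feasibility at every hard core `δ > 0` is feasibility on every configuration of distinct points. -/
theorem forall_feasible_iff_injective (R : ℝ) (Φ : E3 → Finset E3 → ℝ) :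
    (∀ δ : ℝ, 0 < δ → Feasible δ R Φ) ↔
      ∀ (N : ℕ) (x : Fin N → E3), Function.Injective x → ∀ i : Fin N, eInf ≤ siteE R Φ x i := by
  constructor
  · intro h N x hx i
    obtain ⟨δ, hδ, hsep⟩ := exists_sep_of_injective hx
    exact h δ hδ N x hsep i
  · intro h δ hδ N x hsep i
    exact h N x (perturbative_injective_of_sep hδ hsep) i

/-! ## §10  Crux r2 without hard cores -/

/-- **Crux r2 without hard cores.**  `FiniteRangeSplitting` holds iff ONE radius `R > 0` and ONE pattern-reading
pair-splitting rule `Φ` certify `e_∞ ≤` (weighted site energy) at every site of every finite configuration of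
distinct points in `ℝ³`.  The quantifier prefix `∀ δ > 0, ∃ R, ∃ Φ` of the crux collapses to `∃ R, ∃ Φ`. -/
theorem finiteRangeSplitting_iff_uniform :
    Summit.AtomisticToContinuum.Crystallization.Theses.FreeSplittingCertificates.FiniteRangeSplitting ↔
      ∃ R : ℝ, 0 < R ∧ ∃ Φ : E3 → Finset E3 → ℝ, IsRule Φ ∧
        ∀ (N : ℕ) (x : Fin N → E3), Function.Injective x → ∀ i : Fin N, eInf ≤ siteE R Φ x i := by
  rw [finiteRangeSplitting_iff_rung_two_fifths]
  constructor
  · rintro ⟨R, hR, h⟩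
    obtain ⟨Φ, hrule, hf⟩ := exists_rule_forall_sep_of_rungAt_two_fifths hR.le h
    exact ⟨R + 1, by linarith, Φ, hrule, (forall_feasible_iff_injective _ _).1 hf⟩
  · rintro ⟨R, hR, Φ, hrule, h⟩
    exact ⟨R, hR, Φ, hrule, (forall_feasible_iff_injective R Φ).2 h (2 / 5) (by norm_num)⟩

/-- The uniform form with hard cores kept: crux r2 `↔ ∃ R > 0, ∃ Φ, IsRule Φ ∧ ∀ δ > 0, Feasible δ R Φ`. -/
theorem finiteRangeSplitting_iff_exists_rule_forall_sep :
    Summit.AtomisticToContinuum.Crystallization.Theses.FreeSplittingCertificates.FiniteRangeSplitting ↔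
      ∃ R : ℝ, 0 < R ∧ ∃ Φ : E3 → Finset E3 → ℝ, IsRule Φ ∧ ∀ δ : ℝ, 0 < δ → Feasible δ R Φ := by
  rw [finiteRangeSplitting_iff_uniform]
  simp only [forall_feasible_iff_injective]

/-- Crux r2 `↔` ONE radius serves every hard core: `∃ R > 0, ∀ δ > 0, RungAt δ R`. -/
theorem finiteRangeSplitting_iff_exists_radius_forall :
    Summit.AtomisticToContinuum.Crystallization.Theses.FreeSplittingCertificates.FiniteRangeSplitting ↔
      ∃ R : ℝ, 0 < R ∧ ∀ δ : ℝ, 0 < δ → RungAt δ R := by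
  rw [finiteRangeSplitting_iff_exists_rule_forall_sep]
  constructor
  · rintro ⟨R, hR, Φ, hrule, hf⟩
    exact ⟨R, hR, fun δ hδ => ⟨Φ, hrule, hf δ hδ⟩⟩
  · rintro ⟨R, hR, h⟩
    obtain ⟨Φ, hrule, hf⟩ := exists_rule_forall_sep fun n => h _ (by positivity)
    exact ⟨R, hR, Φ, hrule, hf⟩

/-! ## §11  The separation threshold `δ*(R)` along the radius ladder -/

/-- `δ*(R) = 0` iff every hard core carries a rung at radius `R`. -/
theorem sepThreshold_eq_zero_iff (R : ℝ) : sepThreshold R = 0 ↔ ∀ δ : ℝ, 0 < δ → RungAt δ R := by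
  constructor
  · intro h δ hδ
    exact (mem_rungSetAt_of_sepThreshold_lt (by rw [h]; exact hδ)).2
  · intro h
    refine le_antisymm (le_of_forall_gt_imp_ge_of_dense fun δ hδ => ?_) (sepThreshold_nonneg _)
    exact sepThreshold_le_of_mem ⟨hδ, h δ hδ⟩

/-- **Crux r2 `↔ ∃ R > 0, δ*(R) = 0`.** -/
theorem finiteRangeSplitting_iff_exists_sepThreshold_eq_zero :
    Summit.AtomisticToContinuum.Crystallization.Theses.FreeSplittingCertificates.FiniteRangeSplitting ↔
      ∃ R : ℝ, 0 < R ∧ sepThreshold R = 0 := by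
  rw [finiteRangeSplitting_iff_exists_radius_forall]
  simp only [sepThreshold_eq_zero_iff]

/-- Once below `2/5`, the threshold vanishes one unit of radius later and stays zero: `δ*(R) < 2/5`, `R > 0`,
`R + 1 ≤ R'` give `δ*(R') = 0`. -/
theorem sepThreshold_eq_zero_of_lt_two_fifths {R R' : ℝ} (hR : 0 < R) (h : sepThreshold R < 2 / 5)
    (hR' : R + 1 ≤ R') : sepThreshold R' = 0 :=
  le_antisymm ((sepThreshold_antitone hR').trans_eq (sepThreshold_add_one_eq_zero hR h)) (sepThreshold_nonneg _)

/-- **Dichotomy along the radius ladder**: either `2/5 ≤ δ*(R)` at every radius `R > 0`, or `δ*(R) = 0` for all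
large `R`. -/
theorem sepThreshold_dichotomy :
    (∀ R : ℝ, 0 < R → 2 / 5 ≤ sepThreshold R) ∨ ∃ R₀ : ℝ, ∀ R : ℝ, R₀ ≤ R → sepThreshold R = 0 := by
  by_cases h : ∀ R : ℝ, 0 < R → 2 / 5 ≤ sepThreshold R
  · exact Or.inl h
  · right
    push Not at h
    obtain ⟨R, hR, hlt⟩ := h
    exact ⟨R + 1, fun R' hR' => sepThreshold_eq_zero_of_lt_two_fifths hR hlt hR'⟩

/-- The first branch of the dichotomy is exactly the failure of crux r2: `¬ FiniteRangeSplitting ↔ ∀ R > 0,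
2/5 ≤ δ*(R)`. -/
theorem not_finiteRangeSplitting_iff_forall_sepThreshold_ge :
    ¬ Summit.AtomisticToContinuum.Crystallization.Theses.FreeSplittingCertificates.FiniteRangeSplitting ↔
      ∀ R : ℝ, 0 < R → 2 / 5 ≤ sepThreshold R := by
  constructor
  · intro h R _
    exact (not_finiteRangeSplitting_iff_two_fifths_le_critSep.1 h).trans (critSep_le_sepThreshold R)
  · intro h hfrs
    obtain ⟨R, hR, h0⟩ := finiteRangeSplitting_iff_exists_sepThreshold_eq_zero.1 hfrs
    have h1 := h R hR
    rw [h0] at h1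
    norm_num at h1

/-- The second branch is crux r2 in eventual form: `FiniteRangeSplitting ↔ ∀ᶠ R in atTop, δ*(R) = 0`. -/
theorem finiteRangeSplitting_iff_eventually_sepThreshold_eq_zero :
    Summit.AtomisticToContinuum.Crystallization.Theses.FreeSplittingCertificates.FiniteRangeSplitting ↔
      ∀ᶠ R in atTop, sepThreshold R = 0 := by
  constructor
  · intro h
    obtain ⟨R, hR, h0⟩ := finiteRangeSplitting_iff_exists_sepThreshold_eq_zero.1 h
    have hlt : sepThreshold R < 2 / 5 := by rw [h0]; norm_num
    exact Filter.eventually_atTop.2 ⟨R + 1, fun R' hR' => sepThreshold_eq_zero_of_lt_two_fifths hR hlt hR'⟩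
  · intro h
    obtain ⟨R₀, hR₀⟩ := Filter.eventually_atTop.1 h
    exact finiteRangeSplitting_iff_exists_sepThreshold_eq_zero.2
      ⟨max R₀ 1, lt_max_of_lt_right one_pos, hR₀ _ (le_max_left _ _)⟩

/-! ## §12  No radius blow-up as the hard core shrinks -/

/-- **Under crux r2 the minimal rung radius is uniformly bounded**: `∃ R₁, ∀ δ > 0, R*(δ) ≤ R₁`. -/
theorem radThreshold_bounded_of_finiteRangeSplitting
    (h : Summit.AtomisticToContinuum.Crystallization.Theses.FreeSplittingCertificates.FiniteRangeSplitting) :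
    ∃ R₁ : ℝ, 0 < R₁ ∧ ∀ δ : ℝ, 0 < δ → radThreshold δ ≤ R₁ := by
  obtain ⟨R, hR, hall⟩ := finiteRangeSplitting_iff_exists_radius_forall.1 h
  exact ⟨R, hR, fun δ hδ => radThreshold_le_of_mem ⟨hR, hall δ hδ⟩⟩

/-- Crux r2 `↔` the hard cores all lie in `RungSet` with uniformly bounded minimal rung radius. -/
theorem finiteRangeSplitting_iff_radThreshold_bounded :
    Summit.AtomisticToContinuum.Crystallization.Theses.FreeSplittingCertificates.FiniteRangeSplitting ↔
      ∃ R₁ : ℝ, 0 < R₁ ∧ ∀ δ : ℝ, 0 < δ → δ ∈ RungSet ∧ radThreshold δ ≤ R₁ := by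
  constructor
  · intro h
    obtain ⟨R, hR, hall⟩ := finiteRangeSplitting_iff_exists_radius_forall.1 h
    exact ⟨R, hR, fun δ hδ => ⟨⟨hδ, R, hR, hall δ hδ⟩, radThreshold_le_of_mem ⟨hR, hall δ hδ⟩⟩⟩
  · rintro ⟨R₁, hR₁, h⟩
    refine finiteRangeSplitting_iff_exists_radius_forall.2 ⟨R₁ + 1, by linarith, fun δ hδ => ?_⟩
    obtain ⟨hmem, hle⟩ := h δ hδ
    exact (mem_radSetAt_of_radThreshold_lt hδ hmem (by linarith)).2

end Summit.AtomisticToContinuum.Crystallization.Theorems.StrictSplittingRuleBirth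

end
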